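import Literature.NumberTheory.DiophantineGeometry.GenEllDePersistentValues
import HarnessLib

/-!
# [GenEll] Thm. 2.1 for `ℙ¹`, the `D_e` route: persistent family with parameters in a prescribed
# infinite set

S. Mochizuki, *Arithmetic elliptic curves in general position*, Math. J. Okayama Univ. 52 (2010)
[cite: MochizukiGenEll2010, Thm 2.1 p.12].  Variant of `GenEllDePersistentFamily` /
`GenEllDePersistentPolys` / `GenEllDePersistentValues` requested by the assembly of the abc-iut cell's
GenEllTwo package (route item of `Summit.ABC.ABC.Theses.IUTThetaPilot`): the finitely many parameters
`c_i` of the family `t_c = 1/r + c·r^{k+1}/(1−2x)` with pairwise disjoint persistent sets can be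
chosen inside ANY prescribed infinite set `C ⊆ ℚ` (e.g. the powers of `2`, so that the set of bad
places of the mechanisms does not grow with the family), because at each step of the induction only
finitely many parameters are excluded:

* `DeFamily.exists_finset_params_pairwise_disjoint_mem` / `exists_params_pairwise_disjoint_mem` —
  the parameter choice inside `C`;
* `DeFamily.exists_persistent_polys_mem` — the pairwise coprime persistent polynomials
  (`persPoly`) for such parameters, with the root clause at two algebraically closed places;
* `DeFamily.exists_persistent_polys_tval_mem` — the same in the `t_c`-value form.

Theorems only; classical; nothing here bears on the disputed parts of the abc-iut corpus.
-/

noncomputable section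

open Polynomial

namespace Literature.NumberTheory.DiophantineGeometry.GenEll

namespace DeFamily

/-- **Parameters inside a prescribed infinite set, `Finset` form.** For `k ≥ 3`, two fields `Ω₁, Ω₂`
of characteristic `0`, an infinite `C ⊆ ℚ` and every `n`: a set of `n` nonzero rationals IN `C`
whose persistent sets are pairwise disjoint in `Ω₁` and in `Ω₂`. [cite: MochizukiGenEll2010, Thm 2.1 p.12] -/
theorem exists_finset_params_pairwise_disjoint_mem {Ω₁ Ω₂ : Type*} [Field Ω₁] [CharZero Ω₁]
    [Field Ω₂] [CharZero Ω₂] {k : ℕ} (hk : 3 ≤ k) (C : Set ℚ) (hC : C.Infinite) (n : ℕ) :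
    ∃ s : Finset ℚ, s.card = n ∧ (0 : ℚ) ∉ s ∧ (↑s ⊆ C) ∧
      (s : Set ℚ).Pairwise (fun c c' =>
        Disjoint (persistentSet k (c : Ω₁)) (persistentSet k (c' : Ω₁))) ∧
      (s : Set ℚ).Pairwise (fun c c' =>
        Disjoint (persistentSet k (c : Ω₂)) (persistentSet k (c' : Ω₂))) := by
  classical
  induction n with
  | zero => exact ⟨∅, rfl, by simp, by simp, by simp, by simp⟩
  | succ n ih =>
    obtain ⟨s, hcard, h0, hsC, h₁, h₂⟩ := ih
    have hk2 : 2 ≤ k := by omega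
    have hne : ∀ c ∈ (s : Set ℚ), (c : ℚ) ≠ 0 := fun c hc h => h0 (h ▸ hc)
    have hbad₁ : Set.Finite {q : ℚ | ∃ c ∈ (s : Set ℚ), ∃ a ∈ persistentSet k (c : Ω₁),
        a ∈ persistentSet k (q : Ω₁)} := by
      refine ((s.finite_toSet).biUnion fun c hc => finite_badParams_of_finite (Ω := Ω₁) hk
        (finite_persistentSet hk2 (Rat.cast_ne_zero.mpr (hne c hc)))).subset ?_
      rintro q ⟨c, hc, a, ha, ha'⟩
      simp only [Set.mem_iUnion, Set.mem_setOf_eq]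
      exact ⟨c, hc, a, ha, ha'⟩
    have hbad₂ : Set.Finite {q : ℚ | ∃ c ∈ (s : Set ℚ), ∃ a ∈ persistentSet k (c : Ω₂),
        a ∈ persistentSet k (q : Ω₂)} := by
      refine ((s.finite_toSet).biUnion fun c hc => finite_badParams_of_finite (Ω := Ω₂) hk
        (finite_persistentSet hk2 (Rat.cast_ne_zero.mpr (hne c hc)))).subset ?_
      rintro q ⟨c, hc, a, ha, ha'⟩
      simp only [Set.mem_iUnion, Set.mem_setOf_eq]
      exact ⟨c, hc, a, ha, ha'⟩
    obtain ⟨q, hqC, hq⟩ := hC.exists_notMem_finset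
      (insert (0 : ℚ) s ∪ (hbad₁.toFinset ∪ hbad₂.toFinset))
    simp only [Finset.mem_union, Finset.mem_insert, Set.Finite.mem_toFinset, Set.mem_setOf_eq,
      not_or, not_exists, not_and] at hq
    obtain ⟨⟨hq0, hqs⟩, hq₁, hq₂⟩ := hq
    refine ⟨insert q s, by rw [Finset.card_insert_of_notMem hqs, hcard], ?_, ?_, ?_, ?_⟩
    · rw [Finset.mem_insert, not_or]; exact ⟨Ne.symm hq0, h0⟩
    · rw [Finset.coe_insert]; exact Set.insert_subset hqC hsC
    · rw [Finset.coe_insert, Set.pairwise_insert_of_notMem (by exact_mod_cast hqs)]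
      refine ⟨h₁, fun c hc => ?_⟩
      have hd : Disjoint (persistentSet k (q : Ω₁)) (persistentSet k (c : Ω₁)) :=
        Set.disjoint_left.mpr fun a haq hac => hq₁ c hc a hac haq
      exact ⟨hd, hd.symm⟩
    · rw [Finset.coe_insert, Set.pairwise_insert_of_notMem (by exact_mod_cast hqs)]
      refine ⟨h₂, fun c hc => ?_⟩
      have hd : Disjoint (persistentSet k (q : Ω₂)) (persistentSet k (c : Ω₂)) :=
        Set.disjoint_left.mpr fun a haq hac => hq₂ c hc a hac haq
      exact ⟨hd, hd.symm⟩

/-- **Parameters inside a prescribed infinite set, indexed form.** [cite: MochizukiGenEll2010, Thm 2.1 p.12] -/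
theorem exists_params_pairwise_disjoint_mem {Ω₁ Ω₂ : Type*} [Field Ω₁] [CharZero Ω₁] [Field Ω₂]
    [CharZero Ω₂] {k : ℕ} (hk : 3 ≤ k) (C : Set ℚ) (hC : C.Infinite) (n : ℕ) :
    ∃ c : Fin n → ℚ, (∀ i, c i ∈ C) ∧ (∀ i, c i ≠ 0) ∧ Function.Injective c ∧
      Pairwise (fun i j => Disjoint (persistentSet k (c i : Ω₁)) (persistentSet k (c j : Ω₁))) ∧
      Pairwise (fun i j => Disjoint (persistentSet k (c i : Ω₂)) (persistentSet k (c j : Ω₂))) := by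
  classical
  obtain ⟨s, hcard, h0, hsC, h₁, h₂⟩ :=
    exists_finset_params_pairwise_disjoint_mem (Ω₁ := Ω₁) (Ω₂ := Ω₂) hk C hC n
  let e : Fin n ≃ s := (s.equivFinOfCardEq hcard).symm
  refine ⟨fun i => (e i : ℚ), fun i => hsC (e i).2, fun i h => h0 (h ▸ (e i).2), ?_, ?_, ?_⟩
  · intro i j h
    exact e.injective (Subtype.ext h)
  · intro i j hij
    exact h₁ (e i).2 (e j).2 (fun h => hij (e.injective (Subtype.ext h)))
  · intro i j hij
    exact h₂ (e i).2 (e j).2 (fun h => hij (e.injective (Subtype.ext h)))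

/-- **Persistent polynomials for parameters in a prescribed infinite set.** For `k ≥ 3`, `n`, an
infinite `C ⊆ ℚ` and two algebraically closed fields `Ω₁, Ω₂` of characteristic `0`: parameters
`c_i ∈ C ∖ {0}` (pairwise distinct) and `Pers_i := persPoly (c_i)` nonzero, pairwise coprime, vanishing
on the persistent set of `t_{c_i}` in `Ω₁` and in `Ω₂`. [cite: MochizukiGenEll2010, Thm 2.1 p.12] -/
theorem exists_persistent_polys_mem (Ω₁ Ω₂ : Type*) [Field Ω₁] [CharZero Ω₁] [IsAlgClosed Ω₁]
    [Field Ω₂] [CharZero Ω₂] [IsAlgClosed Ω₂] {k : ℕ} (hk : 3 ≤ k) (C : Set ℚ) (hC : C.Infinite)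
    (n : ℕ) :
    ∃ (c : Fin n → ℚ) (Pers : Fin n → ℚ[X]), (∀ i, c i ∈ C) ∧ (∀ i, c i ≠ 0) ∧
      Function.Injective c ∧ (∀ i, Pers i ≠ 0) ∧ Pairwise (fun i j => IsCoprime (Pers i) (Pers j)) ∧
      (∀ i, ∀ a ∈ persistentSet k (c i : Ω₁), aeval a (Pers i) = 0) ∧
      (∀ i, ∀ a ∈ persistentSet k (c i : Ω₂), aeval a (Pers i) = 0) := by
  have hk2 : 2 ≤ k := by omega
  obtain ⟨c, hcC, hc0, hcinj, hdisj, -⟩ := exists_params_pairwise_disjoint_mem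
    (Ω₁ := AlgebraicClosure ℚ) (Ω₂ := AlgebraicClosure ℚ) hk C hC n
  refine ⟨c, fun i => persPoly hk2 (hc0 i), hcC, hc0, hcinj, fun i => persPoly_ne_zero hk2 (hc0 i),
    fun i j hij => isCoprime_persPoly hk2 (hc0 i) (hc0 j) (hdisj hij),
    fun i a ha => aeval_persPoly_eq_zero hk2 (hc0 i) ha,
    fun i a ha => aeval_persPoly_eq_zero hk2 (hc0 i) ha⟩

/-- **The same in the `t_c`-value form** (hypothesis `hCV` of the configuration-protection step,
`CV :=` the critical values of `t_{c_i}`), parameters in a prescribed infinite set.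
[cite: MochizukiGenEll2010, Thm 2.1 p.12] -/
theorem exists_persistent_polys_tval_mem (Ω₁ Ω₂ : Type*) [Field Ω₁] [CharZero Ω₁] [IsAlgClosed Ω₁]
    [Field Ω₂] [CharZero Ω₂] [IsAlgClosed Ω₂] {k : ℕ} (hk : 3 ≤ k) (C : Set ℚ) (hC : C.Infinite)
    (n : ℕ) :
    ∃ (c : Fin n → ℚ) (Pers : Fin n → ℚ[X]), (∀ i, c i ∈ C) ∧ (∀ i, c i ≠ 0) ∧
      Function.Injective c ∧ (∀ i, Pers i ≠ 0) ∧ Pairwise (fun i j => IsCoprime (Pers i) (Pers j)) ∧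
      (∀ i, ∀ z w : Ω₁ × Ω₁, OnCurve k z → z.2 ≠ 0 → 1 - 2 * z.1 ≠ 0 → OnCurve k w →
        N k (c i : Ω₁) w = 0 →
        ((1 - 2 * z.1) + (c i : Ω₁) * z.2 ^ (k + 2)) / (z.2 * (1 - 2 * z.1)) =
          ((1 - 2 * w.1) + (c i : Ω₁) * w.2 ^ (k + 2)) / (w.2 * (1 - 2 * w.1)) →
        aeval z.1 (Pers i) = 0) ∧
      (∀ i, ∀ z w : Ω₂ × Ω₂, OnCurve k z → z.2 ≠ 0 → 1 - 2 * z.1 ≠ 0 → OnCurve k w →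
        N k (c i : Ω₂) w = 0 →
        ((1 - 2 * z.1) + (c i : Ω₂) * z.2 ^ (k + 2)) / (z.2 * (1 - 2 * z.1)) =
          ((1 - 2 * w.1) + (c i : Ω₂) * w.2 ^ (k + 2)) / (w.2 * (1 - 2 * w.1)) →
        aeval z.1 (Pers i) = 0) := by
  obtain ⟨c, Pers, hcC, hc0, hinj, hP0, hcop, h₁, h₂⟩ := exists_persistent_polys_mem Ω₁ Ω₂ hk C hC n
  refine ⟨c, Pers, hcC, hc0, hinj, hP0, hcop, fun i z w hz hr hs hw hN ht => h₁ i z.1 ?_,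
    fun i z w hz hr hs hw hN ht => h₂ i z.1 ?_⟩
  · exact mem_persistentSet_of_tval_eq (Rat.cast_ne_zero.mpr (hc0 i)) hz ⟨hr, hs⟩ hw hN ht
  · exact mem_persistentSet_of_tval_eq (Rat.cast_ne_zero.mpr (hc0 i)) hz ⟨hr, hs⟩ hw hN ht

end DeFamily

end Literature.NumberTheory.DiophantineGeometry.GenEll
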